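import Literature.AlgebraicGeometry.AbelianSchemes.IsLambdaOfAtOfIsBaseChangeVia
import Literature.AlgebraicGeometry.AbelianSchemes.RigidifiedLineBundleSliceHomogeneous
import Literature.AlgebraicGeometry.AbelianSchemes.PolarizationSpreadStage
import Literature.AlgebraicGeometry.AbelianSchemes.AbelianSchemeOverSpreadStageStructure
import Literature.AlgebraicGeometry.Limits.SurjectiveSpread
import HarnessLib

/-!
# SPREAD SEQUEL (s2-λ), transport half: a GENERIC polarization is `Λ(ample)` at the geometric points of the generic base
# read in a STAGE — the `hgen` input of ★ `exists_stage_polarization_of_isOpen_locus` ([MumfordFogartyKirwan1994] Def. 6.3, 7.2)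

Layer `Literature/AlgebraicGeometry/AbelianSchemes`, namespaces `Literature.AlgebraicGeometry.Limits.OverFac` (§1) and
`Literature.AlgebraicGeometry.AbelianSchemes.AbelianSchemeOver` (§2–§4).  THEOREMS ONLY (no definition, no named fact, no instance, no
notation, no `sorry`).  Cell `hodgecm-mathlib` (D-0151), FLOOR 0, P6 «MOD programme» (crux hLiu418 = stmt-HodgeConjecture-24832), SPREAD
door, deal «SPREAD SEQUELS», item «(s2-λ)-transport» (LEAD F0P6-plan (g2) 2026-09-01 22:22:09Z; B-p18 (g37) OWED list 22:19:18Z; B-p18 (g38)).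
Sequel of ★ `AbelianSchemeOverSpreadStageStructure` §4 (`exists_stage_monHom`: the generic `λ` spreads to a homomorphism `λₛ` at a stage,
identified through ★ `OverFac.facObjIso`) and ★ `PolarizationSpreadStage` §3 (`exists_stage_polarization_of_isOpen_locus`: `λₛ` a
polarization generically + open polarization locus ⇒ a polarization at a finer stage).  THIS FILE supplies the bridge between the two:
the generic polarization's ampleness clause, stated for `(𝒜ₜ)_K` at a geometric point `ȳ` of the generic base, is transported to the
clause for `𝒜ₜ|ₛ` at the point `ȳ ≫ ℓ` of the stage (`ℓ` the relative leg) — ★ `IsLambdaOfAtOfIsBaseChangeVia.transfer_of_isBaseChangeVia_fibreIso`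
along the FACTORISATION SQUARE of the two base changes `𝒜 ×_X G → 𝒜 ×_X T` (`G = 𝒜.X ◁ ℓ`, `Ĝ = Â.X ◁ ℓ`, fibre identification
`(𝒜_G)_ȳ ≅ 𝒜_{ȳ ≫ G.hom} = 𝒜_{(ȳ ≫ ℓ) ≫ T.hom} ≅ (𝒜_T)_{ȳ ≫ ℓ}`, Poincaré clause by re-bracketing pull-backs).  HC_CM is proved only
modulo the printed citations until rung 0 closes; this file is generic and changes no count.

* §1 (any base `X`, any `ℓ : G ⟶ T` over `X`, any `X`-schemes `Q`, `R`; the map `G_Q : Q_G → Q_T` of the factorisation square AS A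
  VARIABLE with the two projections of `Q ◁ ℓ`): `facObjIso_hom_left_comp_eq_fst` (`fac_Q ≫ G_Q = pr`, ★ `pullbackFacObjIso_hom_left_whiskerLeft`
  with the map as a variable), `pullback_obj_hom_comp_left_eq` (the square commutes), and **`left_comp_eq_comp_left_of_fac`** — a pair
  `z_T : Q_T → R_T`, `z_G : Q_G → R_G` matched by the ★ `facObjIso` clause `z_T|_G ≫ fac_R = fac_Q ≫ z_G` satisfies the plain square
  `z_G ≫ G_R = G_Q ≫ z_T` (uses ★ `Limits.pullback_map_left_comp_fst`).
* §2 (any abelian scheme `𝒜/X` with dual pair `D`) the Poincaré clause `(G ×_ℓ Ĝ) ≫ c_T = c_G` for the comparison maps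
  `c_• : 𝒜_• ×_• Â_• → 𝒜 ×_X Â` (`pullback_map_fac_comp_prodBaseChangeToProd`), the fibre identification over `G_𝒜`
  (`toSchemeHom_fibreFacIso_hom_comp_fst`), and **`exists_isAmple_isLambdaOfAt_comp_of_fac`**: `λ̄_G = Λ(𝒪(Θ′))` with `Θ′` ample at `ȳ`
  ⟹ `λ̄_T = Λ(𝒪(Θ))` with `Θ` ample at `ȳ ≫ ℓ` (the maps instantiated to `(𝒜.X ◁ ℓ).left`, `(Â.X ◁ ℓ).left`).
* §3 at the localisation tower (`P ⊗ Spec B → P ⊗ D(s) → P ⊗ D(t)`, ★ `LocalizationRelativeGroupSpread`):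
  **`forall_exists_isAmple_isLambdaOfAt_leg_of_polarization`** = LITERALLY the `hgen` binder of ★ `exists_stage_polarization_of_isOpen_locus`
  for `(𝒜ₜ|ₛ, Dₜ|ₛ, λₛ)` from a polarization `pol` of `(𝒜ₜ)_B` for `(Dₜ)_B` and the `facObjIso` clause `λₛ|_B ≫ fac = fac ≫ pol.lam`.
* §4 (`A` a domain, `K = Frac A`, stage flat, `P` qcqs) the assembled heads: **`exists_stage_monHom_hgen_of_polarization`** (★ §4
  `exists_stage_monHom` + §3) and **`exists_stage_polarization_of_polarization_of_isOpen_locus`** (+ ★ `exists_stage_polarization_of_isOpen_locus`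
  under the open-locus hypothesis BY VALUE, [GortzWedhorn2023] Cor. 27.285 shape, for the spread homomorphism): a polarization of the
  generic base change spreads to a polarization two stages down, `s → s₁ → t` (no re-basing to one `stageOver`).

## References
* [MumfordFogartyKirwan1994] D. Mumford, J. Fogarty, F. Kirwan, *Geometric Invariant Theory*, 3rd ed. (1994), Ch. 6 §2 Def. 6.2–6.3
  (p. 120); Ch. 7 §2 Def. 7.2 (p. 129) (polarizations; pull-back of the data along `S′ → S`).
* [EGAIV3] A. Grothendieck, J. Dieudonné, *EGA IV₃* (1966), Thm. 8.8.2 (i).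
* [GortzWedhorn2020] U. Görtz, T. Wedhorn, *Algebraic Geometry I*, 2nd ed. (2020), §(4.7) (4.7.1), Prop. 4.16 (transitivity of base change).
* [GortzWedhorn2023] U. Görtz, T. Wedhorn, *Algebraic Geometry II* (2023), Cor. 27.285 (p. 949).
* [Lan2013PELCompactifications] K.-W. Lan, *Arithmetic compactifications of PEL-type Shimura varieties* (2013), §1.3.6 Lemma 1.3.6.6 (pp. 81–82).
-/

set_option autoImplicit false

noncomputable section

universe u

open CategoryTheory CategoryTheory.Limits AlgebraicGeometry MonoidalCategory CartesianMonoidalCategory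
open scoped MonObj

/-! ## §1 The factorisation square `Q_G → Q_T` over `ℓ : G → T` and the `facObjIso` clause -/

namespace Literature.AlgebraicGeometry.Limits

namespace OverFac

variable {X : Scheme.{u}} {T G : Over X} (ℓ : G ⟶ T) (Q R : Over X)
  (Gm : ((Over.pullback G.hom).obj Q).left ⟶ ((Over.pullback T.hom).obj Q).left)
  (hG₁ : Gm ≫ pullback.fst Q.hom T.hom = pullback.fst Q.hom G.hom)
  (hG₂ : Gm ≫ pullback.snd Q.hom T.hom = pullback.snd Q.hom G.hom ≫ ℓ.left)

set_option backward.isDefEq.respectTransparency false in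
include hG₁ hG₂ in
/-- **The map of the factorisation square against ★ `facObjIso`.**  A morphism `G_Q : Q_G → Q_T` with the two projections of
`Q ◁ ℓ` (`G_Q ≫ pr_Q = pr_Q`, `G_Q ≫ pr_T = pr_G ≫ ℓ`; e.g. `(Q ◁ ℓ).left` itself, Mathlib `Over.whiskerLeft_left_fst∕snd`) is, after the
identification `(Q_T)|_G ≅ Q_G`, the projection `(Q_T)|_G → Q_T` (★ `pullbackFacObjIso_hom_left_whiskerLeft`, map as a variable).
[cite: GortzWedhorn2020, §(4.7) Prop. 4.16] -/
theorem facObjIso_hom_left_comp_eq_fst :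
    (facObjIso ℓ Q).hom.left ≫ Gm = pullback.fst ((Over.pullback T.hom).obj Q).hom ℓ.left := by
  apply pullback.hom_ext
  · rw [Category.assoc, hG₁]
    exact pullbackFacObjIso_hom_left_fst T.hom ℓ.left G.hom (Over.w ℓ) Q
  · rw [Category.assoc, hG₂, pullbackFacObjIso_hom_left_snd_assoc]
    exact pullback.condition.symm

set_option backward.isDefEq.respectTransparency false in
include hG₂ in
/-- The factorisation square commutes: `Q_G → G → T` is `Q_G → Q_T → T`. [cite: GortzWedhorn2020, §(4.7) Prop. 4.16] -/
theorem pullback_obj_hom_comp_left_eq : ((Over.pullback G.hom).obj Q).hom ≫ ℓ.left = Gm ≫ ((Over.pullback T.hom).obj Q).hom := by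
  change pullback.snd Q.hom G.hom ≫ ℓ.left = Gm ≫ pullback.snd Q.hom T.hom
  rw [hG₂]

set_option backward.isDefEq.respectTransparency false in
/-- **THE `facObjIso` CLAUSE IS THE PLAIN SQUARE.**  For `z_T : Q_T → R_T` over `T` and `z_G : Q_G → R_G` over `G` with
`z_T|_G ≫ ((R_T)|_G ≅ R_G) = ((Q_T)|_G ≅ Q_G) ≫ z_G` (★ `facObjIso`, the currency of ★ `exists_stage_monHom` ∕ `exists_stage_ringAction`), and maps
of the factorisation squares `G_Q : Q_G → Q_T`, `G_R : R_G → R_T` (in the sense of `facObjIso_hom_left_comp_eq_fst`), the underlying scheme maps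
satisfy `z_G ≫ G_R = G_Q ≫ z_T` — the `λ`-clause `λ′ ≫ Ĝ = G ≫ λ` of [MumfordFogartyKirwan1994] Def. 7.2.
[cite: GortzWedhorn2020, §(4.7) Prop. 4.16] [cite: MumfordFogartyKirwan1994, Ch. 7 §2 Definition 7.2 (p. 129)] -/
theorem left_comp_eq_comp_left_of_fac (Rm : ((Over.pullback G.hom).obj R).left ⟶ ((Over.pullback T.hom).obj R).left)
    (hGm : (facObjIso ℓ Q).hom.left ≫ Gm = pullback.fst ((Over.pullback T.hom).obj Q).hom ℓ.left)
    (hRm : (facObjIso ℓ R).hom.left ≫ Rm = pullback.fst ((Over.pullback T.hom).obj R).hom ℓ.left)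
    (zT : (Over.pullback T.hom).obj Q ⟶ (Over.pullback T.hom).obj R) (zG : (Over.pullback G.hom).obj Q ⟶ (Over.pullback G.hom).obj R)
    (hz : (Over.pullback ℓ.left).map zT ≫ (facObjIso ℓ R).hom = (facObjIso ℓ Q).hom ≫ zG) :
    zG.left ≫ Rm = Gm ≫ zT.left := by
  -- after the isomorphism `(Q_T)|_G ≅ Q_G` both sides are `pr ≫ z_T`
  have key : (facObjIso ℓ Q).hom.left ≫ zG.left ≫ Rm = (facObjIso ℓ Q).hom.left ≫ Gm ≫ zT.left := by
    rw [← Over.comp_left_assoc, ← hz, Over.comp_left_assoc, hRm, pullback_map_left_comp_fst, reassoc_of% hGm]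
  have hinv : (facObjIso ℓ Q).inv.left ≫ (facObjIso ℓ Q).hom.left = 𝟙 _ := by
    rw [← Over.comp_left, Iso.inv_hom_id, Over.id_left]
  have e1 : zG.left ≫ Rm = (facObjIso ℓ Q).inv.left ≫ (facObjIso ℓ Q).hom.left ≫ zG.left ≫ Rm := by
    rw [reassoc_of% hinv]
  rw [e1, key, reassoc_of% hinv]

end OverFac

end Literature.AlgebraicGeometry.Limits

/-! ## §2 The factorisation square of an abelian scheme with dual pair: Poincaré clause, fibre identification, transport -/

namespace Literature.AlgebraicGeometry.AbelianSchemes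

namespace AbelianSchemeOver

open Literature.AlgebraicGeometry.Motives Literature.AlgebraicGeometry.AbelianVarieties
open Literature.AlgebraicGeometry.Limits Literature.AlgebraicGeometry.Limits.LocApprox Literature.AlgebraicGeometry.Limits.OverFac

section Fac

variable {X : Scheme.{u}} (𝒜 : AbelianSchemeOver X) (D : 𝒜.DualPair) {T G : Over X} (ℓ : G ⟶ T)
  (Gm : (𝒜.baseChange G.hom).X.left ⟶ (𝒜.baseChange T.hom).X.left)
  (hG₁ : Gm ≫ pullback.fst 𝒜.X.hom T.hom = pullback.fst 𝒜.X.hom G.hom)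
  (hG₂ : Gm ≫ pullback.snd 𝒜.X.hom T.hom = pullback.snd 𝒜.X.hom G.hom ≫ ℓ.left)
  (Ĝm : (D.hatBaseChange G.hom).X.left ⟶ (D.hatBaseChange T.hom).X.left)
  (hĜ₁ : Ĝm ≫ pullback.fst D.hat.X.hom T.hom = pullback.fst D.hat.X.hom G.hom)
  (hĜ₂ : Ĝm ≫ pullback.snd D.hat.X.hom T.hom = pullback.snd D.hat.X.hom G.hom ≫ ℓ.left)

set_option backward.isDefEq.respectTransparency false in
include hG₁ hĜ₁ in
/-- **The Poincaré clause of the factorisation square**: the product map `G ×_ℓ Ĝ : 𝒜_G ×_G Â_G → 𝒜_T ×_T Â_T` followed by the comparison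
`𝒜_T ×_T Â_T → 𝒜 ×_X Â` is the comparison `𝒜_G ×_G Â_G → 𝒜 ×_X Â` (componentwise: `G ≫ pr_𝒜 = pr_𝒜`, `Ĝ ≫ pr_Â = pr_Â`), so that
`(G ×_ℓ Ĝ)^*𝒫_T ≅ 𝒫_G` by re-bracketing. [cite: MumfordFogartyKirwan1994, Ch. 7 §2 Definition 7.2 (p. 129)] [cite: GortzWedhorn2020, §(4.7) Prop. 4.16] -/
theorem pullback_map_fac_comp_prodBaseChangeToProd (wG : (𝒜.baseChange G.hom).X.hom ≫ ℓ.left = Gm ≫ (𝒜.baseChange T.hom).X.hom)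
    (wĜ : (D.hatBaseChange G.hom).X.hom ≫ ℓ.left = Ĝm ≫ (D.hatBaseChange T.hom).X.hom) :
    pullback.map (𝒜.baseChange G.hom).X.hom (D.hatBaseChange G.hom).X.hom (𝒜.baseChange T.hom).X.hom (D.hatBaseChange T.hom).X.hom
        Gm Ĝm ℓ.left wG wĜ ≫ D.prodBaseChangeToProd T.hom = D.prodBaseChangeToProd G.hom := by
  apply pullback.hom_ext
  · rw [Category.assoc, DualPair.prodBaseChangeToProd_fst, DualPair.prodBaseChangeToProd_fst, pullback.lift_fst_assoc, Category.assoc,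
      hG₁]
  · rw [Category.assoc, DualPair.prodBaseChangeToProd_snd, DualPair.prodBaseChangeToProd_snd, pullback.lift_snd_assoc, Category.assoc,
      hĜ₁]

variable {L : Type u} [Field L] (y : Spec (.of L) ⟶ G.left)

/-- The point `ȳ ≫ (G → X)` of `X` is `(ȳ ≫ ℓ) ≫ (T → X)`. [cite: GortzWedhorn2020, §(4.7) Prop. 4.16] -/
theorem comp_hom_eq_comp_left_comp_hom : y ≫ G.hom = (y ≫ ℓ.left) ≫ T.hom := by
  rw [Category.assoc, Over.w ℓ]

set_option backward.isDefEq.respectTransparency false in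
include hG₁ hG₂ in
/-- **The fibre identification of the factorisation square lies over `G_𝒜 : 𝒜_G → 𝒜_T`**: the composite
`(𝒜_G)_ȳ ≅ 𝒜_{ȳ ≫ G.hom} = 𝒜_{(ȳ ≫ ℓ) ≫ T.hom} ≅ (𝒜_T)_{ȳ ≫ ℓ}` (★ `fibreBaseChangeIso`, ★ `fibreCongrIso`, ★ `fibreBaseChangeIso⁻¹`) followed by
`(𝒜_T)_{ȳ ≫ ℓ} → 𝒜_T` is `(𝒜_G)_ȳ → 𝒜_G → 𝒜_T` (checked on the two projections of `𝒜_T = 𝒜 ×_X T`). [cite: GortzWedhorn2020, §(4.7) Prop. 4.16] -/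
theorem toSchemeHom_fibreFacIso_hom_comp_fst :
    AbelianVariety.Hom.toSchemeHom
        (𝒜.fibreBaseChangeIso G.hom y ≪≫ 𝒜.fibreCongrIso (comp_hom_eq_comp_left_comp_hom ℓ y) ≪≫
          (𝒜.fibreBaseChangeIso T.hom (y ≫ ℓ.left)).symm).hom ≫
        pullback.fst (𝒜.baseChange T.hom).X.hom (y ≫ ℓ.left) =
      pullback.fst (𝒜.baseChange G.hom).X.hom y ≫ Gm := by
  -- the composite lies over `Spec L`
  have hsnd : AbelianVariety.Hom.toSchemeHom
        (𝒜.fibreBaseChangeIso G.hom y ≪≫ 𝒜.fibreCongrIso (comp_hom_eq_comp_left_comp_hom ℓ y) ≪≫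
          (𝒜.fibreBaseChangeIso T.hom (y ≫ ℓ.left)).symm).hom ≫
        pullback.snd (𝒜.baseChange T.hom).X.hom (y ≫ ℓ.left) = pullback.snd (𝒜.baseChange G.hom).X.hom y :=
    Over.w (𝒜.fibreBaseChangeIso G.hom y ≪≫ 𝒜.fibreCongrIso (comp_hom_eq_comp_left_comp_hom ℓ y) ≪≫
      (𝒜.fibreBaseChangeIso T.hom (y ≫ ℓ.left)).symm).hom.hom.hom.hom
  apply pullback.hom_ext
  · -- projections to `𝒜`: leg by leg
    simp only [Category.assoc]
    rw [hG₁]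
    change AbelianVariety.Hom.toSchemeHom (𝒜.fibreBaseChangeIso G.hom y).hom ≫
        AbelianVariety.Hom.toSchemeHom (𝒜.fibreCongrIso (comp_hom_eq_comp_left_comp_hom ℓ y)).hom ≫
          (𝒜.baseChangeCompGrpIso T.hom (y ≫ ℓ.left)).hom.hom.hom.left ≫
            pullback.fst (pullback.snd 𝒜.X.hom T.hom) (y ≫ ℓ.left) ≫ pullback.fst 𝒜.X.hom T.hom =
      pullback.fst (pullback.snd 𝒜.X.hom G.hom) y ≫ pullback.fst 𝒜.X.hom G.hom
    rw [baseChangeCompGrpIso_hom_left_fst_fst, fibreCongrIso_hom_toSchemeHom_fst, fibreBaseChangeIso_hom_toSchemeHom_fst]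
  · -- projections to `T`: both sides are `pr_{Spec L} ≫ ȳ ≫ ℓ`
    simp only [Category.assoc]
    rw [hG₂]
    have hcT : pullback.fst (𝒜.baseChange T.hom).X.hom (y ≫ ℓ.left) ≫ pullback.snd 𝒜.X.hom T.hom =
        pullback.snd (𝒜.baseChange T.hom).X.hom (y ≫ ℓ.left) ≫ y ≫ ℓ.left := pullback.condition
    have hcG : pullback.fst (𝒜.baseChange G.hom).X.hom y ≫ pullback.snd 𝒜.X.hom G.hom =
        pullback.snd (𝒜.baseChange G.hom).X.hom y ≫ y := pullback.condition
    rw [hcT, reassoc_of% hsnd, reassoc_of% hcG]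

variable (lamT : (𝒜.baseChange T.hom).X ⟶ (D.baseChange T.hom).hat.X) (lamG : (𝒜.baseChange G.hom).X ⟶ (D.baseChange G.hom).hat.X)
  (hz : (Over.pullback ℓ.left).map lamT ≫ (facObjIso ℓ D.hat.X).hom = (facObjIso ℓ 𝒜.X).hom ≫ lamG)

set_option backward.isDefEq.respectTransparency false in
include hz in
/-- **TRANSPORT OF `λ̄ = Λ(ample)` ALONG THE FACTORISATION SQUARE.**  `𝒜/X` an abelian scheme with dual pair `D = (Â, 𝒫)`, `ℓ : G → T` over `X`,
`λ_T : 𝒜_T → Â_T` over `T` and `λ_G : 𝒜_G → Â_G` over `G` matched by the ★ `facObjIso` clause `λ_T|_G ≫ fac_Â = fac_𝒜 ≫ λ_G` (the output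
clause of ★ `exists_stage_monHom`).  If at a field-valued point `ȳ` of `G` one has `λ̄_G = Λ(𝒪(Θ′))` with `Θ′` ample ([MumfordFogartyKirwan1994,
Def. 6.3] at `ȳ`, for the base-changed dual pair `D_G`), then at the point `ȳ ≫ ℓ` of `T` one has `λ̄_T = Λ(𝒪(Θ))` with `Θ` ample (for `D_T`):
★ `transfer_of_isBaseChangeVia_fibreIso` along `(G, Ĝ, f) = (𝒜.X ◁ ℓ, Â.X ◁ ℓ, ℓ)` with the `λ`-clause (§1), the Poincaré clause and the fibre
identification above. [cite: MumfordFogartyKirwan1994, Ch. 6 §2 Definition 6.3 (p. 120) and Ch. 7 §2 Definition 7.2 (p. 129)]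
[cite: Lan2013PELCompactifications, §1.3.6 Lemma 1.3.6.6 (pp. 81–82)] -/
theorem exists_isAmple_isLambdaOfAt_comp_of_fac (Θ' : CartierDivisor ((𝒜.baseChange G.hom).fibre y).toAbelianVariety.X.left)
    (hΘ' : Θ'.IsAmple) (h' : (𝒜.baseChange G.hom).IsLambdaOfAt y (D.baseChange G.hom) lamG Θ') :
    ∃ Θ : CartierDivisor ((𝒜.baseChange T.hom).fibre (y ≫ ℓ.left)).toAbelianVariety.X.left,
      Θ.IsAmple ∧ (𝒜.baseChange T.hom).IsLambdaOfAt (y ≫ ℓ.left) (D.baseChange T.hom) lamT Θ := by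
  -- the maps of the two factorisation squares (`𝒜` and `Â`), typed in the `baseChange` spelling
  let Gm : (𝒜.baseChange G.hom).X.left ⟶ (𝒜.baseChange T.hom).X.left := (𝒜.X ◁ ℓ).left
  have hG₁ : Gm ≫ pullback.fst 𝒜.X.hom T.hom = pullback.fst 𝒜.X.hom G.hom := Over.whiskerLeft_left_fst ℓ
  have hG₂ : Gm ≫ pullback.snd 𝒜.X.hom T.hom = pullback.snd 𝒜.X.hom G.hom ≫ ℓ.left := Over.whiskerLeft_left_snd ℓ
  let Ĝm : (D.hatBaseChange G.hom).X.left ⟶ (D.hatBaseChange T.hom).X.left := (D.hat.X ◁ ℓ).left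
  have hĜ₁ : Ĝm ≫ pullback.fst D.hat.X.hom T.hom = pullback.fst D.hat.X.hom G.hom := Over.whiskerLeft_left_fst ℓ
  have hĜ₂ : Ĝm ≫ pullback.snd D.hat.X.hom T.hom = pullback.snd D.hat.X.hom G.hom ≫ ℓ.left := Over.whiskerLeft_left_snd ℓ
  have wG : (𝒜.baseChange G.hom).X.hom ≫ ℓ.left = Gm ≫ (𝒜.baseChange T.hom).X.hom := pullback_obj_hom_comp_left_eq ℓ 𝒜.X Gm hG₂
  have wĜ : (D.hatBaseChange G.hom).X.hom ≫ ℓ.left = Ĝm ≫ (D.hatBaseChange T.hom).X.hom :=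
    pullback_obj_hom_comp_left_eq ℓ D.hat.X Ĝm hĜ₂
  -- the `λ`-clause from the `facObjIso` clause
  have hlam : lamG.left ≫ Ĝm = Gm ≫ lamT.left :=
    left_comp_eq_comp_left_of_fac ℓ 𝒜.X D.hat.X Gm Ĝm (facObjIso_hom_left_comp_eq_fst ℓ 𝒜.X Gm hG₁ hG₂)
      (facObjIso_hom_left_comp_eq_fst ℓ D.hat.X Ĝm hĜ₁ hĜ₂) lamT lamG hz
  -- the Poincaré clause by re-bracketing
  let eP : (Scheme.Modules.pullback
      (pullback.map (𝒜.baseChange G.hom).X.hom (D.hatBaseChange G.hom).X.hom (𝒜.baseChange T.hom).X.hom (D.hatBaseChange T.hom).X.hom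
        Gm Ĝm ℓ.left wG wĜ)).obj (D.baseChange T.hom).P ≅ (D.baseChange G.hom).P :=
    (Scheme.Modules.pullbackComp _ (D.prodBaseChangeToProd T.hom)).app D.P ≪≫
      (Scheme.Modules.pullbackCongr (𝒜.pullback_map_fac_comp_prodBaseChangeToProd D ℓ Gm hG₁ Ĝm hĜ₁ wG wĜ)).app D.P
  obtain ⟨hA, hΛ⟩ := transfer_of_isBaseChangeVia_fibreIso (𝒜.baseChange T.hom) (D.baseChange T.hom) lamT (𝒜.baseChange G.hom)
    (D.baseChange G.hom) lamG ℓ.left Gm Ĝm wG wĜ hlam y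
    (𝒜.fibreBaseChangeIso G.hom y ≪≫ 𝒜.fibreCongrIso (comp_hom_eq_comp_left_comp_hom ℓ y) ≪≫ (𝒜.fibreBaseChangeIso T.hom (y ≫ ℓ.left)).symm)
    (𝒜.toSchemeHom_fibreFacIso_hom_comp_fst ℓ Gm hG₁ hG₂ y) eP Θ' hΘ' h'
  exact ⟨_, hA, hΛ⟩

end Fac

/-! ## §3 At the localisation tower: the `hgen` input of ★ `exists_stage_polarization_of_isOpen_locus` from a generic polarization -/

section Tower

variable {A : Type u} [CommRing A] {S : Submonoid A} (B : Type u) [CommRing B] [Algebra A B] [IsLocalization S B]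
  {P : SchemeOver A} {s t : Idx S} (σ : s ⟶ t)
  (𝒜ₜ : AbelianSchemeOver (P ⊗ (baseDiagram S).obj t).left) (Dₜ : 𝒜ₜ.DualPair)
  (pol : (𝒜ₜ.baseChange (genOver S B P t).hom).Polarization (Dₜ.baseChange (genOver S B P t).hom))
  (lamₛ : (𝒜ₜ.baseChange (stageOver S P σ).hom).X ⟶ (Dₜ.baseChange (stageOver S P σ).hom).hat.X)
  (hz : (Over.pullback (relLeg S B P σ).left).map lamₛ ≫ (facObjIso (relLeg S B P σ) Dₜ.hat.X).hom =
    (facObjIso (relLeg S B P σ) 𝒜ₜ.X).hom ≫ pol.lam)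

include hz in
/-- **(s2-λ)-TRANSPORT: THE `hgen` INPUT OF ★ `exists_stage_polarization_of_isOpen_locus` FROM A GENERIC POLARIZATION.**  `𝒜ₜ` an abelian scheme
over the stage base `P ⊗ D(t)` with dual pair `Dₜ`, `pol` a polarization of its base change `(𝒜ₜ)_B` to the generic base `P ⊗ Spec B` (for the
base-changed dual pair), `σ : s ⟶ t` a finer stage and `λₛ : 𝒜ₜ|ₛ → Âₜ|ₛ` a `P ⊗ D(s)`-morphism whose base change along the relative leg
`ℓ : P ⊗ Spec B → P ⊗ D(s)` is `pol.lam` through the identifications `(𝒜ₜ|ₛ)_B ≅ (𝒜ₜ)_B`, `(Âₜ|ₛ)_B ≅ (Âₜ)_B` (★ `facObjIso`; the output clause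
of ★ `exists_stage_monHom`).  THEN at every geometric point `ȳ ≫ (P ◁ leg_s)` of `P ⊗ D(s)` coming from the generic base, `λ̄ₛ = Λ(𝒪(Θ))` for an
ample `Θ` — verbatim the hypothesis `hgen` of ★ `exists_stage_polarization_of_isOpen_locus` for `(𝒜ₜ|ₛ, Dₜ|ₛ, λₛ)` (§2 at `ℓ := relLeg σ` with
`Θ′` from `pol.exists_ample`). [cite: MumfordFogartyKirwan1994, Ch. 6 §2 Definition 6.3 (p. 120) and Ch. 7 §2 Definition 7.2 (p. 129)]
[cite: EGAIV3, Thm. 8.8.2 (i)] -/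
theorem forall_exists_isAmple_isLambdaOfAt_leg_of_polarization :
    ∀ (Ω : Type u) [Field Ω] [IsAlgClosed Ω] (yb : Spec (.of Ω) ⟶ (P ⊗ specOver A B).left),
      ∃ Θ : CartierDivisor ((𝒜ₜ.baseChange (stageOver S P σ).hom).fibre (yb ≫ (P ◁ leg S B s).left)).toAbelianVariety.X.left,
        Θ.IsAmple ∧ (𝒜ₜ.baseChange (stageOver S P σ).hom).IsLambdaOfAt (yb ≫ (P ◁ leg S B s).left)
          (Dₜ.baseChange (stageOver S P σ).hom) lamₛ Θ := by
  intro Ω _ _ yb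
  obtain ⟨Θ', hΘ', h'⟩ := pol.exists_ample Ω yb
  exact 𝒜ₜ.exists_isAmple_isLambdaOfAt_comp_of_fac Dₜ (relLeg S B P σ) yb lamₛ pol.lam hz Θ' hΘ' h'

end Tower

/-! ## §4 Over a domain: the assembled heads (★ `exists_stage_monHom` + §3 [+ ★ `exists_stage_polarization_of_isOpen_locus`]) -/

section Assembly

variable {A : Type u} [CommRing A] [IsDomain A] (K : Type u) [Field K] [Algebra A K] [IsFractionRing A K]
  {P : SchemeOver A} [QuasiCompact P.hom] [QuasiSeparated P.hom] {t : Idx (nonZeroDivisors A)}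
  (𝒜ₜ : AbelianSchemeOver (P ⊗ (baseDiagram (nonZeroDivisors A)).obj t).left) (Dₜ : 𝒜ₜ.DualPair)
  (pol : (𝒜ₜ.baseChange (genOver (nonZeroDivisors A) K P t).hom).Polarization (Dₜ.baseChange (genOver (nonZeroDivisors A) K P t).hom))

/-- **A GENERIC POLARIZATION SPREADS TO A STAGE HOMOMORPHISM WHICH IS `Λ(ample)` AT THE POINTS OF THE GENERIC BASE** (`A` a domain, `K = Frac A`,
the stage `P ⊗ D(t) → D(t)` flat, `P` qcqs over `A`): ★ `exists_stage_monHom` applied to `pol.lam : (𝒜ₜ)_K → (Âₜ)_K` gives `σ : s ⟶ t` and a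
homomorphism `λₛ : 𝒜ₜ|ₛ → Âₜ|ₛ` restricting to `pol.lam`; §3 gives the `hgen` clause for it.  Feed ★ `exists_stage_polarization_of_isOpen_locus`
(with its `hopen`) at the stage `s` to finish. [cite: EGAIV3, Thm. 8.8.2 (i)] [cite: MumfordFogartyKirwan1994, Ch. 6 §2 Definition 6.3 (p. 120)] -/
theorem exists_stage_monHom_hgen_of_polarization [Flat (pullback.snd P.hom ((baseDiagram (nonZeroDivisors A)).obj t).hom)] :
    ∃ (s : Idx (nonZeroDivisors A)) (σ : s ⟶ t)
      (lamₛ : (𝒜ₜ.baseChange (stageOver (nonZeroDivisors A) P σ).hom).X ⟶ (Dₜ.baseChange (stageOver (nonZeroDivisors A) P σ).hom).hat.X),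
      IsMonHom lamₛ ∧
        (Over.pullback (relLeg (nonZeroDivisors A) K P σ).left).map lamₛ ≫ (facObjIso (relLeg (nonZeroDivisors A) K P σ) Dₜ.hat.X).hom =
            (facObjIso (relLeg (nonZeroDivisors A) K P σ) 𝒜ₜ.X).hom ≫ pol.lam ∧
          ∀ (Ω : Type u) [Field Ω] [IsAlgClosed Ω] (yb : Spec (.of Ω) ⟶ (P ⊗ specOver A K).left),
            ∃ Θ : CartierDivisor ((𝒜ₜ.baseChange (stageOver (nonZeroDivisors A) P σ).hom).fibre
                (yb ≫ (P ◁ leg (nonZeroDivisors A) K s).left)).toAbelianVariety.X.left,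
              Θ.IsAmple ∧ (𝒜ₜ.baseChange (stageOver (nonZeroDivisors A) P σ).hom).IsLambdaOfAt
                (yb ≫ (P ◁ leg (nonZeroDivisors A) K s).left) (Dₜ.baseChange (stageOver (nonZeroDivisors A) P σ).hom) lamₛ Θ := by
  -- (`[IsMonHom pol.lam]` is passed by term: its codomain `(Dₜ)_K.hat.X` is `(Dₜ.hat)_K.X` only up to unfolding)
  obtain ⟨s, σ, lamₛ, hmon, hz⟩ := @exists_stage_monHom A _ _ K _ _ _ P _ _ t 𝒜ₜ Dₜ.hat _ pol.lam pol.isMonHom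
  exact ⟨s, σ, lamₛ, hmon, hz, forall_exists_isAmple_isLambdaOfAt_leg_of_polarization K σ 𝒜ₜ Dₜ pol lamₛ hz⟩

/-- **A GENERIC POLARIZATION SPREADS TO A POLARIZATION TWO STAGES DOWN, GIVEN THE OPEN LOCUS** (`A` a domain, `K = Frac A`, stage flat, `P` qcqs):
for `pol` a polarization of `(𝒜ₜ)_K` (base-changed dual pair) and the open-locus hypothesis `hopen` BY VALUE ([GortzWedhorn2023] Cor. 27.285 shape,
asked for every finer stage `σ : s₁ ⟶ t` and every homomorphism `λ : 𝒜ₜ|ₛ₁ → Âₜ|ₛ₁` — it is discharged uniformly by the organ «AmpleLocusOpen»),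
there are `σ : s₁ ⟶ t`, a homomorphism `λ₁ : 𝒜ₜ|ₛ₁ → Âₜ|ₛ₁` restricting to `pol.lam` along the relative leg (★ `facObjIso` clause), `ρ : s ⟶ s₁`
and a ★ `Polarization` of `(𝒜ₜ|ₛ₁) ×_{P⊗D(s₁)} (P ⊗ D(s))` for the base-changed dual pair with `lam = λ₁ ×_{P⊗D(s₁)} (P ⊗ D(s))`
(★ `exists_stage_monHom` → §3 → ★ `exists_stage_polarization_of_isOpen_locus`; the re-basing of the double base change to the single stage
`stageOver (ρ ≫ σ)` is left to the consumer's currency). [cite: GortzWedhorn2023, Cor. 27.285 (p. 949)] [cite: EGAIV3, Thm. 8.8.2 (i)]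
[cite: MumfordFogartyKirwan1994, Ch. 6 §2 Definition 6.3 (p. 120)] -/
theorem exists_stage_polarization_of_polarization_of_isOpen_locus
    [Flat (pullback.snd P.hom ((baseDiagram (nonZeroDivisors A)).obj t).hom)]
    (hopen : ∀ (s₁ : Idx (nonZeroDivisors A)) (σ : s₁ ⟶ t)
      (lam : (𝒜ₜ.baseChange (stageOver (nonZeroDivisors A) P σ).hom).X ⟶ (Dₜ.baseChange (stageOver (nonZeroDivisors A) P σ).hom).hat.X)
      [IsMonHom lam] (x : ↥(P ⊗ (baseDiagram (nonZeroDivisors A)).obj s₁).left),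
      (∃ (Ω : Type u) (_ : Field Ω) (_ : IsAlgClosed Ω) (xb : Spec (.of Ω) ⟶ (P ⊗ (baseDiagram (nonZeroDivisors A)).obj s₁).left),
          x ∈ Set.range xb ∧
            ∃ Θ : CartierDivisor ((𝒜ₜ.baseChange (stageOver (nonZeroDivisors A) P σ).hom).fibre xb).toAbelianVariety.X.left,
              Θ.IsAmple ∧ (𝒜ₜ.baseChange (stageOver (nonZeroDivisors A) P σ).hom).IsLambdaOfAt xb
                (Dₜ.baseChange (stageOver (nonZeroDivisors A) P σ).hom) lam Θ) →
        ∃ U : (P ⊗ (baseDiagram (nonZeroDivisors A)).obj s₁).left.Opens, x ∈ U ∧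
          ∀ (Ω : Type u) [Field Ω] [IsAlgClosed Ω] (yb : Spec (.of Ω) ⟶ (P ⊗ (baseDiagram (nonZeroDivisors A)).obj s₁).left),
            Set.range yb ⊆ (U : Set _) →
              ∃ Θ : CartierDivisor ((𝒜ₜ.baseChange (stageOver (nonZeroDivisors A) P σ).hom).fibre yb).toAbelianVariety.X.left,
                Θ.IsAmple ∧ (𝒜ₜ.baseChange (stageOver (nonZeroDivisors A) P σ).hom).IsLambdaOfAt yb
                  (Dₜ.baseChange (stageOver (nonZeroDivisors A) P σ).hom) lam Θ) :
    ∃ (s₁ : Idx (nonZeroDivisors A)) (σ : s₁ ⟶ t)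
      (lam₁ : (𝒜ₜ.baseChange (stageOver (nonZeroDivisors A) P σ).hom).X ⟶ (Dₜ.baseChange (stageOver (nonZeroDivisors A) P σ).hom).hat.X)
      (_ : IsMonHom lam₁)
      (_ : (Over.pullback (relLeg (nonZeroDivisors A) K P σ).left).map lam₁ ≫ (facObjIso (relLeg (nonZeroDivisors A) K P σ) Dₜ.hat.X).hom =
        (facObjIso (relLeg (nonZeroDivisors A) K P σ) 𝒜ₜ.X).hom ≫ pol.lam)
      (s : Idx (nonZeroDivisors A)) (ρ : s ⟶ s₁)
      (pol₁ : ((𝒜ₜ.baseChange (stageOver (nonZeroDivisors A) P σ).hom).baseChange (stageOver (nonZeroDivisors A) P ρ).hom).Polarization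
        ((Dₜ.baseChange (stageOver (nonZeroDivisors A) P σ).hom).baseChange (stageOver (nonZeroDivisors A) P ρ).hom)),
      pol₁.lam = (Over.pullback (stageOver (nonZeroDivisors A) P ρ).hom).map lam₁ := by
  obtain ⟨s₁, σ, lam₁, hmon, hz, hgen⟩ := exists_stage_monHom_hgen_of_polarization K 𝒜ₜ Dₜ pol
  haveI := hmon
  -- (`[IsMonHom lam₁]` is passed by term: the base `(stageOver σ).left` is `(P ⊗ D(s₁)).left` only up to unfolding)
  obtain ⟨s, ρ, pol₁, hpol₁⟩ := @exists_stage_polarization_of_isOpen_locus A _ (nonZeroDivisors A) K _ _ _ P _ s₁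
    (𝒜ₜ.baseChange (stageOver (nonZeroDivisors A) P σ).hom) (Dₜ.baseChange (stageOver (nonZeroDivisors A) P σ).hom) lam₁ hmon
    (hopen s₁ σ lam₁) hgen
  exact ⟨s₁, σ, lam₁, hmon, hz, s, ρ, pol₁, hpol₁⟩

end Assembly

end AbelianSchemeOver

end Literature.AlgebraicGeometry.AbelianSchemes

end
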